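import Summits.Ventures.Crystal3D.Bulk.HullFaceWalk
import HarnessLib

/-!
# LEMMA L, generic form: in a sub-map of the hull fan with all corners `< π` and enough ears,
# every face walk is a CONVEX spherical polygon (route 1 of `HOME/lean/lemmaL/DESIGN.md`, R1.7)

HONEST FRAMING. Part of the venture `Summits/Ventures/Crystal3D` (cell `pub-crystal3d`, phase 2;
seat p3), generic and configuration-free (`X` any finite set of unit vectors of `ℝ³` with `0`
interior to its hull); nothing here mentions GAP(1.26). THE THEOREM:

* **`HullRotSys.faceConvex_of_corners_lt_pi`** — if every corner of the `α`-closed sub-map `S`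
  is `< π` (`RotSys.cornerAt σ_H (fan angles) S z < π` for all `z ∈ S`) and `EarsUp S` holds
  (every closed super-map with all corners `< π` and a face of period `≥ 4` has an ear on such a
  face — true for covering connected sub-maps, `Bulk/HullSubmapEars.lean`), then every face
  walk of `S` is in convex position in the orientation of the walk (`FaceConvex`,
  `Bulk/HullFaceWalk.lean`).

Proof = the ear induction of the cell's `DESIGN-L12-THEORY.md` LEMMA L, on the number of hull
darts outside `S`: a face of period `3` is a (negatively oriented) triangle by the left-turn fact;
otherwise some long face has an ear `e` (`φ_S e = σ_H (α e)`); the diagonal `g` closing the ear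
triangle is added (`S' = S ∪ {g, α g}`: still closed, corners only shrink, so still `< π`); by
induction every face of `S'` is convex; faces of `S` off the ear are faces of `S'` verbatim
(`faceConvex_of_forall_phi_eq`); the face of the ear is the shortened face of `α g` in `S'`
(`RotSys.minimalPeriod_phi_union_ear`, `pow_phi_union_ear_alpha_g`) with the apex glued back by
`convexPos_snoc` (`Bulk/ConvexPositionGluing.lean`).
-/

noncomputable section

namespace Summit.Ventures.Crystal3D

namespace HullRotSys

open Literature.Geometry.DiscreteGeometry Finset Equiv Real InnerProductGeometry Function

variable {X : Finset (EuclideanSpace ℝ (Fin 3))} {hX1 : ∀ y ∈ X, ‖y‖ = 1}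
  {h0 : (0 : EuclideanSpace ℝ (Fin 3)) ∈ interior (convexHull ℝ (X : Set _))}

/-- **THE EAR INDUCTION (LEMMA L, generic form).** For every `α`-closed `S ⊆ hullDarts X` all of
whose corners are `< π` and which satisfies `EarsUp`, every face walk of `S` is convex. -/
theorem faceConvex_of_corners_lt_pi :
    ∀ (N : ℕ) (S : Finset ↥(hullDarts X)), (univ \ S).card = N → RotSys.IsClosed (inv X) S →
      (∀ z ∈ S, RotSys.cornerAt (rot hX1 h0) (dartWeight X) S z < π) → EarsUp hX1 h0 S →
      ∀ d ∈ S, FaceConvex hX1 h0 S d := by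
  intro N
  induction N using Nat.strong_induction_on with
  | _ N ih =>
  intro S hN hS hlt hears d hd
  have hrs : RotSys.IsRotSys (rot hX1 h0) (inv X) := isRotSys
  set φ := RotSys.phi (rot hX1 h0) (inv X) S with hφ
  -- small faces
  by_cases hd3 : facePeriod hX1 h0 S d ≤ 3
  · intro i j k hij hjk hk
    -- only the triple `(0, 1, 2)` of a face of period `3`
    have hi : i = 0 := by omega
    have hj : j = 1 := by omega
    have hk' : k = 2 := by omega
    subst hi; subst hj; subst hk'
    rw [orient3_neg_neg_neg, neg_pos, orient3_swap_left, neg_lt_zero]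
    exact orient3_walk_pos hS hlt hd 0
  -- a long face exists: take an ear `e` on SOME long face
  obtain ⟨e, he, hm4, hear⟩ := hears S Subset.rfl hS hlt ⟨d, hd, by omega⟩
  set m := facePeriod hX1 h0 S e with hmdef
  have hme : minimalPeriod φ e = m := rfl
  -- the ear triangle `e → f₁ → g → e`
  set f1 := φ e with hf1
  set g := rot hX1 h0 (inv X f1) with hgdef
  have hear' : φ e = rot hX1 h0 (inv X e) := hear
  have htri : rot hX1 h0 (inv X (rot hX1 h0 (inv X (φ e)))) = e := by
    rw [hear']; exact rot_inv_rot_inv_rot_inv e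
  -- `g ∉ S`, else the face of `e` would be the triangle
  have hgS : g ∉ S := by
    intro hgS
    have hf1S : f1 ∈ S := RotSys.phi_apply_mem hS he
    have h1 : φ f1 = g := by
      rw [hφ, RotSys.phi_apply]
      exact RotSys.induce_eq_of_first_return _ (hS _ hf1S) Nat.one_pos (by rw [pow_one])
        hgS (fun m hm0 hm1 => absurd hm1 (by omega))
    have h2 : φ g = e := by
      rw [hφ, RotSys.phi_apply]
      refine RotSys.induce_eq_of_first_return _ (hS _ hgS) Nat.one_pos ?_ he
        (fun m hm0 hm1 => absurd hm1 (by omega))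
      rw [pow_one, hgdef, hf1]; exact htri
    have h3 : (φ ^ 3) e = e := by
      rw [pow_succ, pow_two, Perm.mul_apply, Perm.mul_apply, ← hf1, h1, h2]
    have hper : IsPeriodicPt φ 3 e := by
      rw [IsPeriodicPt, IsFixedPt, ← RotSys.pow_apply_eq_iterate]; exact h3
    have := hper.minimalPeriod_le (by norm_num)
    rw [hme] at this
    omega
  -- the enlarged map
  set S' := S ∪ {g, inv X g} with hS'def
  have hsub : S ⊆ S' := subset_union_left
  have hS'c : RotSys.IsClosed (inv X) S' := RotSys.isClosed_union_ear hrs hS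
  have hαgS : inv X g ∉ S := RotSys.alpha_g_not_mem hrs hS hgS
  -- its missing darts are fewer
  have hN' : (univ \ S').card < N := by
    have hlt' : (univ \ S').card < (univ \ S).card := by
      apply Finset.card_lt_card
      refine ⟨sdiff_subset_sdiff Subset.rfl hsub, fun hle => ?_⟩
      have : g ∈ univ \ S := mem_sdiff.2 ⟨mem_univ _, hgS⟩
      have := hle this
      rw [mem_sdiff] at this
      exact this.2 (mem_union_right _ (mem_insert_self _ _))
    rw [hN] at hlt'; exact hlt'
  -- the splice facts
  have hφ'f1 : RotSys.phi (rot hX1 h0) (inv X) S' f1 = g := RotSys.phi_union_ear_f1 hS he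
  have hφ'αg : RotSys.phi (rot hX1 h0) (inv X) S' (inv X g) = (φ ^ 2) e :=
    RotSys.phi_union_ear_alpha_g hrs hS he hgS
  have hφ'g : RotSys.phi (rot hX1 h0) (inv X) S' g = e := RotSys.phi_union_ear_g he htri
  have hφ'last : RotSys.phi (rot hX1 h0) (inv X) S' ((φ ^ (m - 1)) e) = inv X g :=
    RotSys.phi_union_ear_last hrs hS he htri hgS (by rw [hme]; omega)
  -- all corners of `S'` are `< π`
  have hlt' : ∀ z ∈ S', RotSys.cornerAt (rot hX1 h0) (dartWeight X) S' z < π := by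
    intro z hz
    rw [hS'def, mem_union, mem_insert, mem_singleton] at hz
    rcases hz with hz | rfl | rfl
    · exact (cornerAt_mono hsub hz).trans_lt (hlt z hz)
    · -- the corner at `g`: part of the old corner at `α f₁`
      have hx : inv X f1 ∈ S := hS _ (RotSys.phi_apply_mem hS he)
      have hind : RotSys.induce (rot hX1 h0) S' (inv X f1) = g := by
        refine RotSys.induce_eq_of_first_return _ (hsub hx) Nat.one_pos (by rw [pow_one])
          (mem_union_right _ (mem_insert_self _ _)) (fun m hm0 hm1 => absurd hm1 (by omega))
      have hind2 : RotSys.induce (rot hX1 h0) S' g ∈ S := by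
        have : RotSys.induce (rot hX1 h0) S' g = RotSys.phi (rot hX1 h0) (inv X) S' (inv X g) := by
          rw [RotSys.phi_apply, hrs.α_inv]
        rw [this, hφ'αg]
        exact RotSys.phi_pow_apply_mem hS he 2
      have hsplit := RotSys.cornerAt_subset_of_not_mem (rot hX1 h0) (dartWeight X) hsub hx
        (by rw [hind]; exact hgS) (by rw [hind]; exact hind2)
      rw [hind] at hsplit
      have := hlt _ hx
      have h0' := cornerAt_nonneg (hX1 := hX1) (h0 := h0) S' (inv X f1)
      linarith
    · -- the corner at `α g`: part of the old corner at `α f_{m-1}`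
      have hx : inv X ((φ ^ (m - 1)) e) ∈ S := hS _ (RotSys.phi_pow_apply_mem hS he (m - 1))
      have hind : RotSys.induce (rot hX1 h0) S' (inv X ((φ ^ (m - 1)) e)) = inv X g := by
        rw [← RotSys.phi_apply]; exact hφ'last
      have hind2 : RotSys.induce (rot hX1 h0) S' (inv X g) ∈ S := by
        have : RotSys.induce (rot hX1 h0) S' (inv X g) = RotSys.phi (rot hX1 h0) (inv X) S' g := by
          rw [RotSys.phi_apply]
        rw [this, hφ'g]; exact he
      have hsplit := RotSys.cornerAt_subset_of_not_mem (rot hX1 h0) (dartWeight X) hsub hx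
        (by rw [hind]; exact hαgS) (by rw [hind]; exact hind2)
      rw [hind] at hsplit
      have := hlt _ hx
      have h0' := cornerAt_nonneg (hX1 := hX1) (h0 := h0) S' (inv X ((φ ^ (m - 1)) e))
      linarith
  -- the induction hypothesis: every face of `S'` is convex
  have hIHall : ∀ x ∈ S', FaceConvex hX1 h0 S' x :=
    ih _ hN' S' rfl hS'c hlt' (hears.mono hsub)
  -- CASE B: `d` is NOT on the face of the ear — its walk is untouched
  by_cases hsame : ¬ φ.SameCycle e d
  · refine faceConvex_of_forall_phi_eq (S' := S') (fun t => ?_) (hIHall d (hsub hd))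
    set x := faceDart hX1 h0 S d t with hxdef
    have hxS : x ∈ S := faceDart_mem hS hd t
    have hxd : φ.SameCycle d x := ⟨(t : ℤ), by rw [zpow_natCast]; rfl⟩
    have key := RotSys.phi_eq_splice hrs hS hgS hxS
    rw [← hgdef, ← hS'def, ← hφ] at key
    -- `φ' x ≠ g` (else `x = f₁`, on the face of `e`) and `φ' x ≠ α g` (else `φ x = e`)
    have hne1 : RotSys.phi (rot hX1 h0) (inv X) S' x ≠ g := by
      intro heq
      rw [← hφ'f1] at heq
      have hxf1 : x = f1 := (RotSys.phi (rot hX1 h0) (inv X) S').injective heq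
      apply hsame
      have h1 : φ.SameCycle e f1 := ⟨1, by rw [zpow_one]⟩
      exact h1.trans (hxf1 ▸ hxd.symm)
    have hne2 : RotSys.phi (rot hX1 h0) (inv X) S' x ≠ inv X g := by
      intro heq
      rw [if_neg hne1, if_pos heq, hφ'g] at key
      -- `φ x = e`: `e` on the face of `d`
      apply hsame
      have h1 : φ.SameCycle x e := ⟨1, by rw [zpow_one, key]⟩
      exact (hxd.trans h1).symm
    rw [if_neg hne1, if_neg hne2] at key
    exact key.symm
  -- CASE A: `d` is on the face of the ear: prove the face of `e` convex, then shift
  rw [not_not] at hsame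
  obtain ⟨r, -, hr⟩ := RotSys.SameCycle.exists_lt_minimalPeriod hsame
  have hdr : d = faceDart hX1 h0 S e r := by unfold faceDart; rw [← hφ, hr]
  rw [hdr]
  refine FaceConvex.shift ?_ r
  -- the induction hypothesis on the shortened face of `α g`
  have hIH : FaceConvex hX1 h0 S' (inv X g) :=
    hIHall (inv X g) (mem_union_right _ (mem_insert_of_mem (mem_singleton_self _)))
  -- its walk: period `m − 1`, vertices `v₀, v₂, v₃, …, v_{m−1}`
  have hper' : facePeriod hX1 h0 S' (inv X g) = m - 1 :=
    RotSys.minimalPeriod_phi_union_ear hrs hS he htri hgS (by rw [hme]; omega)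
  set v := faceVertex hX1 h0 S e with hvdef
  set u := faceVertex hX1 h0 S' (inv X g) with hudef
  have hu0 : u 0 = v 0 := by
    rw [hudef, hvdef]
    unfold faceVertex
    rw [faceDart_zero, faceDart_zero, inv_apply_val, Prod.fst_swap]
    -- `g.1.2`: the head of `g` is the tail of `σ (α g) = e`
    have : (rot hX1 h0 (inv X g)).1.1 = (inv X g).1.1 := by
      have := rot_pow_apply_fst (hX1 := hX1) (h0 := h0) 1 (inv X g)
      rwa [pow_one] at this
    rw [inv_apply_val, Prod.fst_swap] at this
    rw [← this, hgdef, hf1, htri]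
  have huk : ∀ k, 1 ≤ k → k + 2 ≤ m → u k = v (k + 1) := by
    intro k hk1 hk
    rw [hudef, hvdef]
    unfold faceVertex faceDart
    rw [RotSys.pow_phi_union_ear_alpha_g hrs hS he htri hgS hk1 (by rw [hme]; omega)]
  -- the vertices of the walk of `e`, rotated to start at `v₂`, with `v₁` appended
  set w : ℕ → EuclideanSpace ℝ (Fin 3) := fun s => -v ((s + 2) % m) with hwdef
  have hwv : ∀ s, s ≤ m - 3 → w s = -v (s + 2) := by
    intro s hs; rw [hwdef]; simp only; rw [Nat.mod_eq_of_lt (by omega)]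
  have hwm2 : w (m - 2) = -v 0 := by
    rw [hwdef]; simp only
    rw [show m - 2 + 2 = m by omega, Nat.mod_self]
  have hwm1 : w (m - 1) = -v 1 := by
    rw [hwdef]; simp only
    rw [show m - 1 + 2 = 1 + m by omega, Nat.add_mod_right, Nat.mod_eq_of_lt (by omega)]
  -- `w 0, …, w (m-2)` is the IH walk rotated by one: convex position
  have hwcp : ∀ i j k, i < j → j < k → k < m - 1 → 0 < orient3 (w i) (w j) (w k) := by
    have hrot := convexPos_rotate hIH 1
    rw [hper'] at hrot
    refine convexPos_congr (w := fun i => -u ((i + 1) % (m - 1))) ?_ hrot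
    intro s hs
    show w s = -u ((s + 1) % (m - 1))
    rcases Nat.lt_or_ge s (m - 2) with hs2 | hs2
    · rw [Nat.mod_eq_of_lt (by omega), huk (s + 1) (by omega) (by omega), hwv s (by omega)]
    · have hs' : s = m - 2 := by omega
      rw [hs', show m - 2 + 1 = m - 1 by omega, Nat.mod_self, hu0, hwm2]
  -- glue the ear's apex `v₁` back
  have hsnoc := convexPos_snoc (n := m - 1) (w := w) (by omega) hwcp
    (by
      rw [show m - 1 - 2 = m - 3 by omega, show m - 1 - 1 = m - 2 by omega, hwv (m - 3) le_rfl,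
        show m - 3 + 2 = m - 1 by omega, hwm2, hwm1, orient3_neg_neg_neg, neg_pos,
        orient3_swap_left, neg_lt_zero]
      have := orient3_walk_pos hS hlt he (m - 1)
      rw [show m - 1 + 1 = 0 + facePeriod hX1 h0 S e by omega,
        show m - 1 + 2 = 1 + facePeriod hX1 h0 S e by omega, faceVertex_add_period,
        faceVertex_add_period] at this
      exact this)
    (by
      rw [show m - 1 - 1 = m - 2 by omega, show m - 1 = m - 2 + 1 by omega, hwm2]
      rw [show m - 2 + 1 = m - 1 by omega, hwm1, show w 0 = -v 2 from hwv 0 (by omega),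
        orient3_neg_neg_neg, neg_pos, orient3_swap_left, neg_lt_zero]
      exact orient3_walk_pos hS hlt he 0)
    (by
      rw [hwm1, show w 0 = -v 2 from hwv 0 (by omega)]
      have h13 : w 1 = -v 3 := by
        rcases Nat.lt_or_ge 4 m with h5 | h4
        · exact hwv 1 (by omega)
        · -- `m = 4`: `w 1 = w (m - 3)`
          have : m = 4 := by omega
          rw [hwdef]; simp only; rw [this]
      rw [h13, orient3_neg_neg_neg, neg_pos, orient3_swap_left, neg_lt_zero]
      exact orient3_walk_pos hS hlt he 1)
  -- read the result back on the walk of `e`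
  rw [show m - 1 + 1 = m by omega] at hsnoc
  have hrot := convexPos_rotate hsnoc (m - 2)
  intro i j k hij hjk hk
  rw [← hmdef] at hk
  have key : ∀ s, s < m → w ((s + (m - 2)) % m) = -v s := by
    intro s hs
    have hidx : ((s + (m - 2)) % m + 2) % m = s := by
      rcases Nat.lt_or_ge s 2 with h2 | h2
      · rw [Nat.mod_eq_of_lt (by omega : s + (m - 2) < m), show s + (m - 2) + 2 = s + m by omega,
          Nat.add_mod_right, Nat.mod_eq_of_lt hs]
      · rw [show s + (m - 2) = (s - 2) + m by omega, Nat.add_mod_right,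
          Nat.mod_eq_of_lt (by omega : s - 2 < m), show s - 2 + 2 = s by omega, Nat.mod_eq_of_lt hs]
    rw [hwdef]; simp only
    rw [hidx]
  have := hrot i j k hij hjk hk
  rw [key i (by omega), key j (by omega), key k hk] at this
  exact this

end HullRotSys

end Summit.Ventures.Crystal3D
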